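import Mathlib.Analysis.Calculus.ImplicitContDiff
import Mathlib.Analysis.Calculus.ContDiff.RCLike
import Mathlib.LinearAlgebra.FiniteDimensional.Lemmas
import Mathlib.LinearAlgebra.FreeModule.Finite.Matrix
import Mathlib.Topology.Algebra.Module.FiniteDimension
import HarnessLib

/-!
# NE7ImplicitCriticalPoint — A C¹ BRANCH OF CRITICAL POINTS FROM A COERCIVE SECOND DERIVATIVE (abstract, finite-dimensional): for `g : Y × Σ → ℝ` of class `C²` at `0` with `∂_σ g(0,0) = 0` and
# `c‖v‖² ≤ (D²_σ g(0,0) v) v` (`c > 0`), there is `σ⋆ : Y → Σ`, `C¹` at `0`, `σ⋆ 0 = 0`, with `∂_σ g(y, σ⋆(y)) = 0` for `y` near `0`, and every critical point `(y, σ)` of `g(y, ·)` near `0` has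
# `σ = σ⋆(y)` — Mathlib's `C^n` implicit function theorem (`ContDiffAt.implicitFunction`) applied to the partial gradient `(y,σ) ↦ ∂_σ g(y,σ) ∈ Σ →L[ℝ] ℝ`, whose `σ`-differential (the slice
# Hessian) is injective by coercivity hence invertible (finite dimension) — step (P5) of the C¹ rung of the datum-dependence of `U_k(V)` (ROAD-G114 §7), to be fed by
# `NE7QuadraticGrowthSecondDerivative.second_derivative_ge_of_quadratic_growth` (✓ p823109)

Cell `pub-balaban`, rung (B)+1 sub-cell t4, lineage `b2b-balaban-t4-ne7-p1` (CRUX PROVER NE7 #1 = OWNER of BINDER row NE7), generation 114.  Memo `t4/b2b-balaban-t4-ne7-p1-g114/ROAD-G114.md` §7.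
WHAT ([folklore]; 0 def, 0 sorry).  **`implicit_critical_point`**.
HONEST FRAMING (page 1): abstract finite-dimensional calculus; nothing of Bałaban's; NOT NE7, NOT NE3; spine 0∕9; finite T⁴ rung (B)+1 — NOT infinite volume, NOT mass gap, NOT BetaPertH, NOT Clay.
-/

set_option autoImplicit false

open scoped Topology
open Set Filter Metric Module

namespace Summit.QuantumFields.BalabanUV.T4Continuum.NE7ImplicitCriticalPoint

variable {Y Sg : Type*} [NormedAddCommGroup Y] [NormedSpace ℝ Y] [FiniteDimensional ℝ Y] [NormedAddCommGroup Sg] [NormedSpace ℝ Sg] [FiniteDimensional ℝ Sg]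

set_option maxHeartbeats 800000 in
/-- **A C¹ BRANCH OF CRITICAL POINTS.**  `g : Y × Σ → ℝ` `C²` at `0`; `fderiv (g(0,·)) 0 = 0`; `c > 0` with `c‖v‖² ≤ (fderiv (fderiv (g(0,·))) 0 v) v` for all `v`.  THEN `∃ σ⋆ : Y → Σ`, `C¹` at `0`,
`σ⋆ 0 = 0`, `∀ᶠ y, fderiv (g(y,·)) (σ⋆ y) = 0`, and `∀ᶠ p : Y × Σ, fderiv (g(p.1,·)) p.2 = 0 ↔ σ⋆ p.1 = p.2`. [folklore] -/
theorem implicit_critical_point {g : Y × Sg → ℝ} (hg : ContDiffAt ℝ 2 g 0) (hcrit : fderiv ℝ (fun σ : Sg => g (0, σ)) 0 = 0) {c : ℝ} (hc : 0 < c)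
    (hcoer : ∀ v : Sg, c * ‖v‖ ^ 2 ≤ (fderiv ℝ (fderiv ℝ (fun σ : Sg => g (0, σ))) 0 v) v) :
    ∃ σs : Y → Sg, ContDiffAt ℝ 1 σs 0 ∧ σs 0 = 0 ∧ (∀ᶠ y in 𝓝 (0 : Y), fderiv ℝ (fun σ : Sg => g (y, σ)) (σs y) = 0) ∧
      (∀ᶠ p : Y × Sg in 𝓝 0, fderiv ℝ (fun σ : Sg => g (p.1, σ)) p.2 = 0 ↔ σs p.1 = p.2) := by
  haveI : CompleteSpace Y := FiniteDimensional.complete ℝ _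
  haveI : CompleteSpace Sg := FiniteDimensional.complete ℝ _
  haveI : CompleteSpace (Sg →L[ℝ] ℝ) := FiniteDimensional.complete ℝ _
  -- the partial gradient `F(y,σ) = ∂_σ g(y,σ)` as `(fderiv g p) ∘ inr`, `C¹` at `0`
  set F : Y × Sg → (Sg →L[ℝ] ℝ) := fun p => (fderiv ℝ g p).comp (ContinuousLinearMap.inr ℝ Y Sg) with hFdef
  have hFc : ContDiffAt ℝ 1 F 0 := (ContDiffAt.fderiv_right (m := 1) hg (by norm_num)).clm_comp contDiffAt_const
  -- near `0`, `F p` IS the derivative of the restriction `σ ↦ g(p.1, σ)` at `p.2`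
  have hev : ∀ᶠ p : Y × Sg in 𝓝 0, ContDiffAt ℝ 2 g p := hg.eventually (by simp)
  have hres : ∀ p : Y × Sg, ContDiffAt ℝ 2 g p → fderiv ℝ (fun σ : Sg => g (p.1, σ)) p.2 = F p := by
    intro p hp
    have hι : HasFDerivAt (fun σ : Sg => ((p.1, σ) : Y × Sg)) (ContinuousLinearMap.inr ℝ Y Sg) p.2 := hasFDerivAt_prodMk_right p.1 p.2
    have hgp : HasFDerivAt g (fderiv ℝ g p) ((fun σ : Sg => ((p.1, σ) : Y × Sg)) p.2) := (hp.differentiableAt (by norm_num)).hasFDerivAt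
    exact (HasFDerivAt.comp p.2 hgp hι).fderiv
  have hFev : ∀ᶠ p : Y × Sg in 𝓝 0, fderiv ℝ (fun σ : Sg => g (p.1, σ)) p.2 = F p := hev.mono hres
  have hF0 : F 0 = 0 := by rw [← hres 0 hg]; exact hcrit
  -- the slice Hessian `H = (∂_σ F)(0)` equals `D²(g(0,·))(0)`
  set φ : Sg → ℝ := fun σ => g (0, σ) with hφ
  have hFres : (fun σ : Sg => F (0, σ)) =ᶠ[𝓝 0] fderiv ℝ φ := by
    have h0 : Tendsto (fun σ : Sg => ((0 : Y), σ)) (𝓝 0) (𝓝 (0 : Y × Sg)) :=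
      (hasFDerivAt_prodMk_right (𝕜 := ℝ) (0 : Y) (0 : Sg)).continuousAt.tendsto
    filter_upwards [h0.eventually hev] with σ hσ
    exact (hres (0, σ) hσ).symm
  have hFd : HasFDerivAt F (fderiv ℝ F 0) 0 := (hFc.differentiableAt (by norm_num)).hasFDerivAt
  have hH : (fderiv ℝ F 0).comp (ContinuousLinearMap.inr ℝ Y Sg) = fderiv ℝ (fderiv ℝ φ) 0 := by
    have h1 : HasFDerivAt (fun σ : Sg => F (0, σ)) ((fderiv ℝ F 0).comp (ContinuousLinearMap.inr ℝ Y Sg)) 0 := by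
      have hF' : HasFDerivAt F (fderiv ℝ F 0) ((fun σ : Sg => ((0 : Y), σ)) 0) := hFd
      exact hF'.comp 0 (hasFDerivAt_prodMk_right (0 : Y) (0 : Sg))
    have h2 : HasFDerivAt (fderiv ℝ φ) ((fderiv ℝ F 0).comp (ContinuousLinearMap.inr ℝ Y Sg)) 0 := h1.congr_of_eventuallyEq hFres.symm
    exact h2.fderiv.symm
  -- coercivity ⇒ injective ⇒ invertible
  have hinj : Function.Injective ((fderiv ℝ F 0).comp (ContinuousLinearMap.inr ℝ Y Sg)) := by
    rw [hH]
    refine (injective_iff_map_eq_zero _).mpr fun v hv => ?_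
    have h := hcoer v
    rw [hv, zero_apply] at h
    have h2 : ‖v‖ ^ 2 ≤ 0 := by nlinarith
    exact norm_eq_zero.mp (by nlinarith [norm_nonneg v])
  have hdim : finrank ℝ Sg = finrank ℝ (Sg →L[ℝ] ℝ) := by
    rw [← (LinearMap.toContinuousLinearMap : (Sg →ₗ[ℝ] ℝ) ≃ₗ[ℝ] (Sg →L[ℝ] ℝ)).finrank_eq, Module.finrank_linearMap_self]
  set eL := LinearMap.linearEquivOfInjective (((fderiv ℝ F 0).comp (ContinuousLinearMap.inr ℝ Y Sg) : Sg →L[ℝ] (Sg →L[ℝ] ℝ)) : Sg →ₗ[ℝ] (Sg →L[ℝ] ℝ)) hinj hdim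
    with heL
  have hinv : ((fderiv ℝ F 0).comp (ContinuousLinearMap.inr ℝ Y Sg)).IsInvertible := by
    refine ⟨eL.toContinuousLinearEquiv, ?_⟩
    ext v
    rfl
  -- the implicit function
  set σs : Y → Sg := hFc.implicitFunction one_ne_zero hinv with hσs
  refine ⟨σs, ?_, ?_, ?_, ?_⟩
  · have h := hFc.contDiffAt_implicitFunction one_ne_zero hinv; simpa using h
  · have h := hFc.implicitFunction_apply_self one_ne_zero hinv; simpa using h
  · have h := hFc.eventually_apply_implicitFunction one_ne_zero hinv
    rw [hF0] at h
    have h1 : ∀ᶠ y : Y in 𝓝 0, F (y, σs y) = 0 := by simpa using h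
    -- transfer to the restriction: `(y, σ⋆ y) → 0`
    have hσc : ContinuousAt σs 0 := by
      have hc := hFc.contDiffAt_implicitFunction one_ne_zero hinv; simp at hc; exact hc.continuousAt
    have hσ0 : σs 0 = 0 := by have h := hFc.implicitFunction_apply_self one_ne_zero hinv; simpa using h
    have hpair : Tendsto (fun y : Y => ((y, σs y) : Y × Sg)) (𝓝 0) (𝓝 0) := by
      have h2 := (continuousAt_id.prodMk hσc).tendsto
      rw [id, hσ0] at h2
      exact h2
    filter_upwards [h1, hpair.eventually hFev] with y hy hy'
    rw [hy']; exact hy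
  · have h := hFc.eventually_apply_eq_iff_implicitFunction one_ne_zero hinv
    rw [hF0] at h
    filter_upwards [h, hFev] with p hp hp'
    rw [hp']; exact hp

end Summit.QuantumFields.BalabanUV.T4Continuum.NE7ImplicitCriticalPoint
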